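import Summits.HodgeConjecture.HodgeConjecture.Theorems.R90S4EpsNormTransversal   -- ★ (this seat, FILE 1∕2 of M4): `sum_classEpsOrbitalIntegral_mul_eq_stableEpsOrbitalIntegral_mul_of_normTransversal` (the norm fibre sum); brings ★ FILE α `R90S4TwistedCartanNormFibres`, ★ C-TT `R90S4TwistedTransferDefs` (`stableEpsOrbitalIntegral`, `IsStablyEpsConjAt`, `IsEpsNormPair`), ★ `Ch4Sec10` (`classEpsOrbitalIntegral`)
import HarnessLib

/-!
# R90-TF · S4 «Ch. 13.1–2», T-WIF road, head M4 (NORM-PUSH) — PUSHING THE TORUS SIDE OF THE ε-TWISTED WEYL FORMULA ALONG THE NORM: averaging over a finite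
# family of measure-preserving maps ∕ a finite kernel costs the factor `|K|`, and lands on the stable integrand of the norm (Rogawski 1990, §12.5 p. 186; §4.3 p. 43)

Cell `hodgecm-mathlib`, crux H413 (`stmt-HodgeConjecture-24833`, lane `--supports … --as helper`), route of record `HCCMUnconditional` (no route verbs;
count-neutral).  Programme R90-TF, section S4 = [Rogawski1990] Ch. 13.1–13.2; seat R90-C131-p03 (g3); head M4 of the HEADS SHEETS `R90/R90-C131-p03/g2/HEADS-TWIF-tube.md`
§2 ∕ `HEADS-TWIF-tube.v2.md` §5′, FILE 2∕2 (S4 dealer K2E2-plan (g7), GO 2026-09-05T00:50:28Z: «(M4-a) generic finite-kernel push … state it for a surjective continuous hom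
of LCA groups with FINITE kernel and σ invariant under the kernel — no S4 tokens, so M2∕CMP′ reuse it»); FILE 1∕2 = ★ `R90S4EpsNormTransversal` (M4-b, the norm fibre sum).
THEOREMS ONLY — no `def`, no instance, no notation, no named-fact hypothesis, no `sorry`; ★-only imports (one S4 `Theorems` file of this seat), never `Lines`.

HONEST LABEL: HC_CM is proved only modulo the 7 printed citations (2 remaining named inputs: hLiu418 = stmt-HodgeConjecture-24832, h413 =
stmt-HodgeConjecture-24833) until rung 0 closes.  Finite sums and measure-preserving maps; discharges no socket by itself — the twisted tube Jacobian (J̃), «compatible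
measures» (CMP′), (FIN)∕(IDX), (DICT)∕(WEYL-COUNT) are HYPOTHESES of the consumers or untouched (REL ≠ ★ ≠ BUILT).

## The mathematics

PRINT [Rogawski1990 §12.5 p. 186]: «the sequence `1 → Z̃T̃ᴺ → T̃ —N→ Z∖T → 1` is exact.  … The measure `dg` on `Z̃∖G̃` and the measure … used to define `Φ^{st}_ε(δ, φ)`
determine a measure on `Z̃∖Z̃T = Z∖T` … By the above sequence, this defines a measure on `Z̃T̃ᴺ∖T̃` which we take to be `dδ`» — the torus variable runs over
`T̃ ∕ T̃ᴺ ≅ T` THROUGH THE NORM.  The tube map of the plan of record parametrises by `T̃ ⧸ (1−ε)T̃`, which sits over `T` with FINITE kernel `K_T = T̃ᴺ ∕ (1−ε)T̃`;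
passing from one to the other is a finite average:
* §1 (M4-a) GENERIC (no S4 token — reusable by M2 ∕ CMP′): for a finite family of measurable maps `κ_i : X → X` preserving `σ`, `∫ Σ_i F(κ_i x) dσ = |ι| · ∫ F dσ`
  (Lebesgue and Bochner forms); for a group homomorphism `p : A → B` with FINITE kernel and `σ` invariant under left translation by the kernel, the fibre of `p`
  through `a` is `(Ker p) · a`, so `∫ (Σ_{a′ ∈ p⁻¹(p a)} F a′) dσ(a) = |Ker p| · ∫ F dσ`, and — when the fibre sum is measurable on `B` — `∫_B (Σ_{a′ ∈ p⁻¹ b} F a′) d(p_*σ)(b)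
  = |Ker p| · ∫_A F dσ` («pushing along a finite-kernel homomorphism costs the factor `|K|`»).  No topology is used: at locally compact groups with Borel σ-algebras
  `MeasurableMul` holds, and continuity ∕ surjectivity of `p` only matter for reading `p_*σ` as a measure on all of `B`.
* §2 NORM-PUSH, ASSEMBLY FORM (the shape (B1)'s by-shape head consumes): on ANY torus parameter space `X` with radial measure `σ`, torus point `τ : X → G̃_v` and norm
  `N̄ : X → G_v`, if finitely many `σ`-preserving maps `κ_i` move `τ x` through a norm transversal over `N̄ x` for `σ`-a.e. `x` (the `K_T`-translations of
  `T̃ ⧸ (1−ε)T̃` once (J̃) makes `σ` `K_T`-invariant; ★ FILE 1 `normTransversal_mul_of_kernelRepresentatives`), then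
  `|ι| · ∫ Φ_ε(⟦τ x⟧, φ) β(τ x) dσ = ∫ Φ^{st}_ε(sec₀ (N̄ x), φ) β(sec₀ (N̄ x)) dσ` for every everywhere-norm section `sec₀` (★ `exists_normSection`) and ε-stable `β` —
  §1 + ★ FILE 1's fibre sum, pointwise a.e.; the integrand is now a function of the norm, ready for (CMP′)'s push-forward `N̄_*σ = |K_T| · D² · t_T`.

[cite: Rogawski1990, §12.5 p. 186; §4.10 (4.10.1) p. 57; §3.11 Prop. 3.11.1 (a) p. 34; §4.3 p. 43]
-/

set_option autoImplicit false
-- the mandated namespace repeats the single-problem summit's segment (`HodgeConjecture.HodgeConjecture`)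
set_option linter.dupNamespace false

noncomputable section

open MeasureTheory
open scoped NumberField Matrix MatrixGroups ENNReal

namespace Summit.HodgeConjecture.HodgeConjecture.R90.S4

open Literature.NumberTheory.Rogawski1990 Literature.NumberTheory.Rogawski1990.Ch4Sec10
open Literature.NumberTheory.Automorphic
open IsDedekindDomain NumberField

/-! ## §1 (M4-a) Generic: averaging over a finite family of measure-preserving maps; the finite-kernel push -/

section FiniteFamily

variable {X : Type*} [MeasurableSpace X] {σ : Measure X} {ι : Type*} [Fintype ι] {κ : ι → X → X}

/-- **Averaging over a finite family of measure-preserving maps (Lebesgue form)**: if each `κ_i : X → X` is measurable with `(κ_i)_* σ = σ`, then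
`∫⁻ Σ_i F(κ_i x) dσ = |ι| · ∫⁻ F dσ` for measurable `F ≥ 0` — each summand has the same integral as `F`.  (The `K_T`-average on the torus side of the twisted
Weyl integration formula.) [cite: Rogawski1990, §12.5 p. 186] -/
theorem lintegral_sum_comp_eq_card_mul_of_map_eq (hκ : ∀ i, Measurable (κ i)) (hσ : ∀ i, Measure.map (κ i) σ = σ)
    {F : X → ℝ≥0∞} (hF : Measurable F) :
    ∫⁻ x, ∑ i, F (κ i x) ∂σ = (Fintype.card ι : ℝ≥0∞) * ∫⁻ x, F x ∂σ := by
  rw [lintegral_finsetSum (f := fun i x => F (κ i x)) Finset.univ (fun i _ => hF.comp (hκ i))]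
  have h : ∀ i ∈ (Finset.univ : Finset ι), ∫⁻ x, F (κ i x) ∂σ = ∫⁻ x, F x ∂σ := fun i _ => by
    rw [← lintegral_map hF (hκ i), hσ i]
  rw [Finset.sum_congr rfl h, Finset.sum_const, Finset.card_univ, nsmul_eq_mul]

/-- **Averaging over a finite family of measure-preserving maps (Bochner form)**: if each `κ_i` is measurable with `(κ_i)_* σ = σ` and `F` is `σ`-integrable
(Banach-valued), then `∫ Σ_i F(κ_i x) dσ = |ι| • ∫ F dσ`.  Integrability is needed (without it the left side can be finite and nonzero while the right side is
`0` by convention). [cite: Rogawski1990, §12.5 p. 186] -/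
theorem integral_sum_comp_eq_card_smul_of_map_eq (hκ : ∀ i, Measurable (κ i)) (hσ : ∀ i, Measure.map (κ i) σ = σ)
    {E : Type*} [NormedAddCommGroup E] [NormedSpace ℝ E] {F : X → E} (hF : Integrable F σ) :
    ∫ x, ∑ i, F (κ i x) ∂σ = (Fintype.card ι : ℝ) • ∫ x, F x ∂σ := by
  have hi : ∀ i ∈ (Finset.univ : Finset ι), Integrable (fun x => F (κ i x)) σ := fun i _ => by
    have h1 : Integrable F (Measure.map (κ i) σ) := by rw [hσ i]; exact hF
    exact h1.comp_measurable (hκ i)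
  rw [integral_finsetSum Finset.univ hi]
  have h : ∀ i ∈ (Finset.univ : Finset ι), ∫ x, F (κ i x) ∂σ = ∫ x, F x ∂σ := fun i _ => by
    have h1 : AEStronglyMeasurable F (Measure.map (κ i) σ) := by rw [hσ i]; exact hF.aestronglyMeasurable
    rw [← integral_map (hκ i).aemeasurable h1, hσ i]
  rw [Finset.sum_congr rfl h, Finset.sum_const, Finset.card_univ, ← Nat.cast_smul_eq_nsmul ℝ]

/-- **Bochner form, `ℂ`-valued**: `∫ Σ_i F(κ_i x) dσ = |ι| · ∫ F dσ` as a product in `ℂ`. [cite: Rogawski1990, §12.5 p. 186] -/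
theorem integral_sum_comp_eq_card_mul_of_map_eq (hκ : ∀ i, Measurable (κ i)) (hσ : ∀ i, Measure.map (κ i) σ = σ)
    {F : X → ℂ} (hF : Integrable F σ) :
    ∫ x, ∑ i, F (κ i x) ∂σ = (Fintype.card ι : ℂ) * ∫ x, F x ∂σ := by
  rw [integral_sum_comp_eq_card_smul_of_map_eq hκ hσ hF, Complex.real_smul, Complex.ofReal_natCast]

end FiniteFamily

section FiniteKernel

variable {A B : Type*} [Group A] [Group B]

/-- **The fibre of a homomorphism through `a` is the kernel-translate of `a`**: `p⁻¹(p a) = (Ker p) · a`. [cite: Rogawski1990, §12.5 p. 186] -/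
theorem preimage_singleton_apply_eq_image_ker (p : A →* B) (a : A) :
    p ⁻¹' {p a} = (fun k => k * a) '' (p.ker : Set A) := by
  ext a'
  simp only [Set.mem_preimage, Set.mem_singleton_iff, Set.mem_image, SetLike.mem_coe, MonoidHom.mem_ker]
  constructor
  · intro h
    refine ⟨a' * a⁻¹, ?_, by group⟩
    rw [map_mul, map_inv, h, mul_inv_cancel]
  · rintro ⟨k, hk, rfl⟩
    rw [map_mul, hk, one_mul]

/-- **Fibre sums are kernel sums**: `Σ_{a′ ∈ p⁻¹(p a)} F a′ = Σ_{k ∈ Ker p} F(k a)` (as `finsum`s; `k ↦ k a` is injective). [cite: Rogawski1990, §12.5 p. 186] -/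
theorem finsum_mem_fibre_eq_finsum_mem_ker {M : Type*} [AddCommMonoid M] (p : A →* B) (F : A → M) (a : A) :
    ∑ᶠ a' ∈ p ⁻¹' {p a}, F a' = ∑ᶠ k ∈ (p.ker : Set A), F (k * a) := by
  rw [preimage_singleton_apply_eq_image_ker p a, finsum_mem_image (mul_left_injective a).injOn]

/-- For a FINITE kernel the kernel sum is a `Finset` sum over `hK.toFinset`. [cite: Rogawski1990, §12.5 p. 186] -/
theorem finsum_mem_fibre_eq_sum_toFinset {M : Type*} [AddCommMonoid M] (p : A →* B) (hK : (p.ker : Set A).Finite) (F : A → M) (a : A) :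
    ∑ᶠ a' ∈ p ⁻¹' {p a}, F a' = ∑ k ∈ hK.toFinset, F (k * a) := by
  rw [finsum_mem_fibre_eq_finsum_mem_ker, finsum_mem_eq_finite_toFinset_sum _ hK]

/-- `|hK.toFinset| = |Ker p|` (`Nat.card` of the kernel). [cite: Rogawski1990, §12.5 p. 186] -/
theorem card_toFinset_ker_eq_nat_card (p : A →* B) (hK : (p.ker : Set A).Finite) : hK.toFinset.card = Nat.card p.ker := by
  rw [← Set.ncard_eq_toFinset_card _ hK, ← Nat.card_coe_set_eq, SetLike.coe_sort_coe]

variable [MeasurableSpace A] [MeasurableMul A]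

/-- **(M4-a) THE FINITE-KERNEL PUSH, Lebesgue form.**  Let `p : A → B` be a group homomorphism with FINITE kernel and `σ` a measure on `A` invariant under left
translation by every element of the kernel.  Then for measurable `F ≥ 0`: `∫⁻ (Σ_{a′ ∈ p⁻¹(p a)} F a′) dσ(a) = |Ker p| · ∫⁻ F dσ` — summing `F` over the fibres of
`p` multiplies the integral by the order of the kernel.  (Print: the torus variable of the twisted Weyl formula runs over `T̃ ∕ T̃ᴺ ≅ T` through the norm; between
`T̃ ∕ (1−ε)T̃` and `T` sits the finite kernel `K_T = T̃ᴺ ∕ (1−ε)T̃`.) [cite: Rogawski1990, §12.5 p. 186; §3.11 Prop. 3.11.1 (a) p. 34] -/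
theorem lintegral_finsum_fibre_eq_card_ker_mul (p : A →* B) (hK : (p.ker : Set A).Finite) {σ : Measure A}
    (hσ : ∀ k ∈ p.ker, Measure.map (fun a => k * a) σ = σ) {F : A → ℝ≥0∞} (hF : Measurable F) :
    ∫⁻ a, ∑ᶠ a' ∈ p ⁻¹' {p a}, F a' ∂σ = (Nat.card p.ker : ℝ≥0∞) * ∫⁻ a, F a ∂σ := by
  simp only [finsum_mem_fibre_eq_sum_toFinset p hK]
  rw [lintegral_finsetSum (f := fun k a => F (k * a)) _ (fun k _ => hF.comp (measurable_const_mul k))]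
  have h : ∀ k ∈ hK.toFinset, ∫⁻ a, F (k * a) ∂σ = ∫⁻ a, F a ∂σ := fun k hk => by
    rw [← lintegral_map hF (measurable_const_mul k), hσ k (hK.mem_toFinset.1 hk)]
  rw [Finset.sum_congr rfl h, Finset.sum_const, nsmul_eq_mul, card_toFinset_ker_eq_nat_card]

/-- **(M4-a) THE FINITE-KERNEL PUSH, Bochner form** (Banach-valued integrable `F`): `∫ (Σ_{a′ ∈ p⁻¹(p a)} F a′) dσ(a) = |Ker p| • ∫ F dσ`.
[cite: Rogawski1990, §12.5 p. 186; §3.11 Prop. 3.11.1 (a) p. 34] -/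
theorem integral_finsum_fibre_eq_card_ker_smul (p : A →* B) (hK : (p.ker : Set A).Finite) {σ : Measure A}
    (hσ : ∀ k ∈ p.ker, Measure.map (fun a => k * a) σ = σ)
    {E : Type*} [NormedAddCommGroup E] [NormedSpace ℝ E] {F : A → E} (hF : Integrable F σ) :
    ∫ a, ∑ᶠ a' ∈ p ⁻¹' {p a}, F a' ∂σ = (Nat.card p.ker : ℝ) • ∫ a, F a ∂σ := by
  simp only [finsum_mem_fibre_eq_sum_toFinset p hK]
  have hi : ∀ k ∈ hK.toFinset, Integrable (fun a => F (k * a)) σ := fun k hk => by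
    have h1 : Integrable F (Measure.map (fun a => k * a) σ) := by rw [hσ k (hK.mem_toFinset.1 hk)]; exact hF
    exact h1.comp_measurable (measurable_const_mul k)
  rw [integral_finsetSum _ hi]
  have h : ∀ k ∈ hK.toFinset, ∫ a, F (k * a) ∂σ = ∫ a, F a ∂σ := fun k hk => by
    have h1 : AEStronglyMeasurable F (Measure.map (fun a => k * a) σ) := by
      rw [hσ k (hK.mem_toFinset.1 hk)]; exact hF.aestronglyMeasurable
    rw [← integral_map (measurable_const_mul k).aemeasurable h1, hσ k (hK.mem_toFinset.1 hk)]
  rw [Finset.sum_congr rfl h, Finset.sum_const, ← Nat.cast_smul_eq_nsmul ℝ, card_toFinset_ker_eq_nat_card]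

variable [MeasurableSpace B]

/-- **(M4-a) PUSHED FORWARD, Lebesgue form**: if moreover `p` is measurable and the fibre sum `b ↦ Σ_{a′ ∈ p⁻¹ b} F a′` is measurable on `B`, then
`∫⁻_B (Σ_{a′ ∈ p⁻¹ b} F a′) d(p_*σ)(b) = |Ker p| · ∫⁻_A F dσ` — «pushing `σ` along a finite-kernel homomorphism costs exactly the factor `|Ker p|`».
[cite: Rogawski1990, §12.5 p. 186; §3.11 Prop. 3.11.1 (a) p. 34] -/
theorem lintegral_map_finsum_fibre_eq_card_ker_mul (p : A →* B) (hp : Measurable p) (hK : (p.ker : Set A).Finite) {σ : Measure A}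
    (hσ : ∀ k ∈ p.ker, Measure.map (fun a => k * a) σ = σ) {F : A → ℝ≥0∞} (hF : Measurable F)
    (hm : Measurable fun b => ∑ᶠ a' ∈ p ⁻¹' {b}, F a') :
    ∫⁻ b, ∑ᶠ a' ∈ p ⁻¹' {b}, F a' ∂(Measure.map p σ) = (Nat.card p.ker : ℝ≥0∞) * ∫⁻ a, F a ∂σ := by
  rw [lintegral_map hm hp]
  exact lintegral_finsum_fibre_eq_card_ker_mul p hK hσ hF

/-- **(M4-a) PUSHED FORWARD, Bochner form**: with `p` measurable and the fibre sum a.e.-strongly measurable for `p_*σ`,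
`∫_B (Σ_{a′ ∈ p⁻¹ b} F a′) d(p_*σ)(b) = |Ker p| • ∫_A F dσ`. [cite: Rogawski1990, §12.5 p. 186; §3.11 Prop. 3.11.1 (a) p. 34] -/
theorem integral_map_finsum_fibre_eq_card_ker_smul (p : A →* B) (hp : Measurable p) (hK : (p.ker : Set A).Finite) {σ : Measure A}
    (hσ : ∀ k ∈ p.ker, Measure.map (fun a => k * a) σ = σ)
    {E : Type*} [NormedAddCommGroup E] [NormedSpace ℝ E] {F : A → E} (hF : Integrable F σ)
    (hm : AEStronglyMeasurable (fun b => ∑ᶠ a' ∈ p ⁻¹' {b}, F a') (Measure.map p σ)) :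
    ∫ b, ∑ᶠ a' ∈ p ⁻¹' {b}, F a' ∂(Measure.map p σ) = (Nat.card p.ker : ℝ) • ∫ a, F a ∂σ := by
  rw [integral_map hp.aemeasurable hm]
  exact integral_finsum_fibre_eq_card_ker_smul p hK hσ hF

end FiniteKernel

/-! ## §2 NORM-PUSH, assembly form: on any torus parameter space, averaging the single-class integrand over a norm-transversal family gives the stable integrand of the norm -/

section Assembly

variable {L : Type} [Field L] [NumberField L] [IsCMField L] {Φ : GL (Fin 3) L}
  {v : HeightOneSpectrum (𝓞 ↥(maximalRealSubfield L))}
  [∀ δ : GtLoc L v, MeasurableSpace (GtLoc L v ⧸ epsCentralizer (epsLoc L Φ v) δ)]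

/-- **NORM-PUSH (M4), ASSEMBLY FORM.**  Let `Φ` be hermitian, `mGt` any ε-orbital family, `φ` any integrand, `β` an ε-stable class function, and `sec₀ : G_v → G̃_v` an
everywhere-norm section (`γ ∈ 𝒩(sec₀ γ)` for all `γ`, ★ `exists_normSection`).  On a measurable space `X` (the torus parameter space of the tube map, e.g. `T̃ ⧸ (1−ε)T̃`)
with a measure `σ` (the radial measure), let `τ : X → G̃_v` (torus point) and `N̄ : X → G_v` (its norm), and let `κ_i : X → X` (`i ∈ ι` finite) be measurable maps
PRESERVING `σ` such that for `σ`-a.e. `x` the family `i ↦ τ(κ_i x)` is a norm transversal over `N̄ x` (norms `= N̄ x`, pairwise ε-inequivalent, meeting every ε-class of that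
norm).  If `x ↦ Φ_ε(⟦τ x⟧, φ) β(τ x)` is `σ`-integrable, then
`|ι| · ∫ Φ_ε(⟦τ x⟧, φ) β(τ x) dσ(x) = ∫ Φ^{st}_ε(sec₀ (N̄ x), φ) β(sec₀ (N̄ x)) dσ(x)` — §1 (averaging) + §2 (fibre sum) pointwise a.e.; the right-hand integrand is a function
of the norm alone, ready to be pushed to `T` along `N̄` by (CMP′). [cite: Rogawski1990, §12.5 p. 186; §4.10 (4.10.1) p. 57; §4.3 p. 43] -/
theorem card_mul_integral_classEpsOrbitalIntegral_mul_eq_integral_stable_norm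
    (hΦ : ((Φ : GL (Fin 3) L) : Matrix (Fin 3) (Fin 3) L)ᵀ.map (IsCMField.complexConj L) = (Φ : Matrix (Fin 3) (Fin 3) L))
    (mGt : EpsOrbitalMeasureFamily (epsLoc L Φ v) ⊥) (φ : GtLoc L v → ℂ)
    (β : GtLoc L v → ℂ) (hβ : ∀ δ δ' : GtLoc L v, IsStablyEpsConjAt L Φ v δ δ' → β δ = β δ')
    (sec₀ : (UnitaryGroup.cmDatum L 3 (Φ : Matrix (Fin 3) (Fin 3) L)).Local v → GtLoc L v) (hsec₀ : ∀ γ, IsEpsNormPair L Φ v (sec₀ γ) γ)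
    {X : Type*} [MeasurableSpace X] {σ : Measure X} (τ : X → GtLoc L v) (Nbar : X → (UnitaryGroup.cmDatum L 3 (Φ : Matrix (Fin 3) (Fin 3) L)).Local v)
    {ι : Type*} [Fintype ι] {κ : ι → X → X} (hκ : ∀ i, Measurable (κ i)) (hσ : ∀ i, Measure.map (κ i) σ = σ)
    (htr : ∀ᵐ x ∂σ, (∀ i, epsNorm (epsLoc L Φ v) (τ (κ i x)) = (Nbar x).val) ∧
      (∀ i j, IsEpsConj (epsLoc L Φ v) (τ (κ i x)) (τ (κ j x)) → i = j) ∧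
      (∀ t : GtLoc L v, epsNorm (epsLoc L Φ v) t = (Nbar x).val → ∃ i, IsEpsConj (epsLoc L Φ v) (τ (κ i x)) t))
    (hint : Integrable (fun x => classEpsOrbitalIntegral (epsLoc L Φ v) mGt φ
      (Quotient.mk (Relation.EqvGen.setoid (epsConjModRel (epsLoc L Φ v) ⊥)) (τ x)) * β (τ x)) σ) :
    (Fintype.card ι : ℂ) * ∫ x, classEpsOrbitalIntegral (epsLoc L Φ v) mGt φ
        (Quotient.mk (Relation.EqvGen.setoid (epsConjModRel (epsLoc L Φ v) ⊥)) (τ x)) * β (τ x) ∂σ =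
      ∫ x, stableEpsOrbitalIntegral L Φ v mGt φ (sec₀ (Nbar x)) * β (sec₀ (Nbar x)) ∂σ := by
  rw [← integral_sum_comp_eq_card_mul_of_map_eq hκ hσ hint]
  refine integral_congr_ae ?_
  filter_upwards [htr] with x hx
  obtain ⟨hN, hinj, hcov⟩ := hx
  exact sum_classEpsOrbitalIntegral_mul_eq_stableEpsOrbitalIntegral_mul_of_normTransversal hΦ (hsec₀ (Nbar x)) mGt φ
    (fun i => τ (κ i x)) hN hinj hcov β hβ

/-- **NORM-PUSH, assembly form with the section as the base point**: same, with the transversal condition read at `τ x` itself — if `κ_{i₀} = id` for some `i₀` is not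
assumed, one still has, for `σ`-a.e. `x`, `Φ^{st}_ε(τ(κ_i x), φ) = Φ^{st}_ε(sec₀ (N̄ x), φ)` for every `i` (common norm; ★ stable ε-conjugacy invariance is not even needed:
both are the same transversal sum).  Recorded as the pointwise identity `Σ_i Φ_ε(⟦τ(κ_i x)⟧, φ) β(τ(κ_i x)) = Φ^{st}_ε(δ₀, φ) β(δ₀)` for ANY `δ₀` with `N̄ x ∈ 𝒩(δ₀)`.
[cite: Rogawski1990, §12.5 p. 186; §4.10 (4.10.1) p. 57] -/
theorem sum_classEpsOrbitalIntegral_mul_comp_eq_stable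
    (hΦ : ((Φ : GL (Fin 3) L) : Matrix (Fin 3) (Fin 3) L)ᵀ.map (IsCMField.complexConj L) = (Φ : Matrix (Fin 3) (Fin 3) L))
    (mGt : EpsOrbitalMeasureFamily (epsLoc L Φ v) ⊥) (φ : GtLoc L v → ℂ)
    (β : GtLoc L v → ℂ) (hβ : ∀ δ δ' : GtLoc L v, IsStablyEpsConjAt L Φ v δ δ' → β δ = β δ')
    {X : Type*} (τ : X → GtLoc L v) {γ : (UnitaryGroup.cmDatum L 3 (Φ : Matrix (Fin 3) (Fin 3) L)).Local v} {δ₀ : GtLoc L v}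
    (hδ₀ : IsEpsNormPair L Φ v δ₀ γ) {ι : Type*} [Fintype ι] (κ : ι → X → X) (x : X)
    (hN : ∀ i, epsNorm (epsLoc L Φ v) (τ (κ i x)) = γ.val)
    (hinj : ∀ i j, IsEpsConj (epsLoc L Φ v) (τ (κ i x)) (τ (κ j x)) → i = j)
    (hcov : ∀ t : GtLoc L v, epsNorm (epsLoc L Φ v) t = γ.val → ∃ i, IsEpsConj (epsLoc L Φ v) (τ (κ i x)) t) :
    ∑ i, classEpsOrbitalIntegral (epsLoc L Φ v) mGt φ
        (Quotient.mk (Relation.EqvGen.setoid (epsConjModRel (epsLoc L Φ v) ⊥)) (τ (κ i x))) * β (τ (κ i x)) =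
      stableEpsOrbitalIntegral L Φ v mGt φ δ₀ * β δ₀ :=
  sum_classEpsOrbitalIntegral_mul_eq_stableEpsOrbitalIntegral_mul_of_normTransversal hΦ hδ₀ mGt φ (fun i => τ (κ i x)) hN hinj hcov β hβ

end Assembly

end Summit.HodgeConjecture.HodgeConjecture.R90.S4

end
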